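import Summits.NavierStokesRegularity.FunctionalMining.StretchingLaminateBurkholderDefs
import Mathlib.Analysis.InnerProductSpace.Basic
import Mathlib.Analysis.SpecialFunctions.Sqrt
import Mathlib.Tactic.FieldSimp
import Mathlib.Tactic.Linarith
import HarnessLib

/-!
# FunctionalMining — towards `BurkConcave` (6): a line through Burkholder's domain in the `(q, p)` parametrisation

search for candidate a priori estimates; no regularity claim.  Cell `pub-nsfunc`, prove seat gen 7.  Sixth set of bricks for the
DISCHARGE of the typed hypothesis `Laminate.BurkConcave` (Burkholder 1991, LNM 1464, §8): the dictionary between the line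
`t ↦ (x + th, y + tk)` of a real inner product space and the real parameters of files `…ConcaveRegions/Seams`:
`‖x + th‖² = q(t) = a + 2bt + ct²` with `a = ‖x‖²`, `b = ⟪x, h⟫`, `c = ‖h‖²` (and `p(t) = d + 2et + ft²` for `y, k`),
`u_λ(x + th, y + tk) = uProf λ (√q(t)) (√p(t))`, Cauchy–Schwarz `e² ≤ df`, and the domain `{‖x + th‖ ≤ 1}` as the explicit
closed interval between the roots of `q = 1` (`c > 0`, `a ≤ 1`).  Also the evaluation of the profile `uProf` on the closed
regions `D₂`, `D₃`, `D₄` off the sphere (companions of `Burk.uProf_D0`, `Burk.uProf_D1` of file `…BurkholderDefs`).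
HONEST SIZE: bookkeeping.  Nothing about Navier–Stokes.
-/

noncomputable section

namespace Summit.NavierStokesRegularity.FunctionalMining

namespace Burk

open Literature.Probability.Process Set
open scoped InnerProductSpace

/-! ## The profile on the closed regions `D₂`, `D₃`, `D₄` (off the sphere) -/

/-- **On `D₄` (closed, off the sphere): `uProf λ r z = 1`** for `r < 1`, `0 ≤ z`, `λ² − 1 + r² ≤ z²`, `λ > 2` (on the
seam `z² = λ² − 1 + r²` the `D₃` formula gives the same value). [ours; bookkeeping] -/
theorem uProf_D4 {lam r z : ℝ} (hlam : 2 < lam) (hr1 : r < 1) (hz : 0 ≤ z)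
    (h : lam ^ 2 - 1 + r ^ 2 ≤ z ^ 2) : uProf lam r z = 1 := by
  unfold uProf
  rw [if_neg hr1.ne]
  by_cases h4 : lam ^ 2 - 1 + r ^ 2 < z ^ 2
  · rw [if_pos h4]
  · have he : z ^ 2 = lam ^ 2 - 1 + r ^ 2 := le_antisymm (not_lt.1 h4) h
    have h3 : lam - 1 + r ≤ z := by
      rcases lt_or_ge z (lam - 1 + r) with hlt | hge
      · exfalso
        nlinarith [mul_self_lt_mul_self hz hlt,
          mul_nonneg (by linarith : (0:ℝ) ≤ lam - 1) (by linarith : (0:ℝ) ≤ 1 - r)]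
      · exact hge
    rw [if_neg h4, if_pos h3, he]
    ring

/-- **On `D₃` (closed, off the sphere): `uProf λ r z = 1 − (λ² − 1 − z² + r²)/(4(λ − 1))`** for `r ≠ 1`,
`λ − 1 + r ≤ z`, `z² ≤ λ² − 1 + r²`. [ours; bookkeeping] -/
theorem uProf_D3 {lam r z : ℝ} (hr1 : r ≠ 1) (h3 : lam - 1 + r ≤ z) (h4 : z ^ 2 ≤ lam ^ 2 - 1 + r ^ 2) :
    uProf lam r z = 1 - (lam ^ 2 - 1 - z ^ 2 + r ^ 2) / (4 * (lam - 1)) := by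
  unfold uProf
  rw [if_neg hr1, if_neg (not_lt.2 h4), if_pos h3]

/-- **On `D₂` (closed, off the sphere): `uProf λ r z = (1 − r²)/((λ − z)² + 1 − r²)`** for `0 ≤ r < 1`,
`λ − 1 − r ≤ z ≤ λ − 1 + r`, `λ > 2` (on the seam `z = λ − 1 + r` the `D₃` formula gives the same value `(1 + r)/2`).
[ours; bookkeeping] -/
theorem uProf_D2 {lam r z : ℝ} (hlam : 2 < lam) (hr0 : 0 ≤ r) (hr1 : r < 1) (h2 : lam - 1 - r ≤ z)
    (h3 : z ≤ lam - 1 + r) : uProf lam r z = (1 - r ^ 2) / ((lam - z) ^ 2 + 1 - r ^ 2) := by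
  unfold uProf
  have hz : 0 ≤ z := by linarith
  have h4 : ¬ (lam ^ 2 - 1 + r ^ 2 < z ^ 2) := by
    intro hcon
    nlinarith [mul_le_mul_of_nonneg_left h3 hz, mul_le_mul_of_nonneg_right h3 (by linarith : (0:ℝ) ≤ lam - 1 + r),
      mul_nonneg (by linarith : (0:ℝ) ≤ lam - 1) (by linarith : (0:ℝ) ≤ 1 - r)]
  rw [if_neg hr1.ne, if_neg h4]
  rcases h3.lt_or_eq with h3 | h3
  · rw [if_neg (not_le.2 h3), if_pos h2]
  · rw [if_pos h3.ge, h3]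
    have e : (lam - (lam - 1 + r)) ^ 2 + 1 - r ^ 2 = 2 * (1 - r) := by ring
    rw [e]
    have h1r : (1 - r) ≠ 0 := by
      intro h0
      exact hr1.ne (by linarith)
    have hl1 : lam - 1 ≠ 0 := by
      intro h0
      linarith
    field_simp
    ring

/-! ## A line `t ↦ (x + th, y + tk)` in the `(q, p)` parametrisation -/

/-- Strict subordination of the increments, `‖k‖ < ‖h‖`, in the form `f < c` and `0 < c`. [ours; bookkeeping] -/
theorem norm_sq_lt_of_norm_lt {F : Type*} [NormedAddCommGroup F] {h k : F} (hk : ‖k‖ < ‖h‖) :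
    ‖k‖ ^ 2 < ‖h‖ ^ 2 ∧ 0 < ‖h‖ ^ 2 := by
  have hk0 : 0 ≤ ‖k‖ := norm_nonneg k
  have hh : 0 < ‖h‖ := lt_of_le_of_lt hk0 hk
  exact ⟨by nlinarith, by positivity⟩

variable {E : Type*} [NormedAddCommGroup E] [InnerProductSpace ℝ E]

/-- `‖x + th‖² = ‖x‖² + 2⟪x, h⟫t + ‖h‖²t²` (the quadratic `q(t) = a + 2bt + ct²`). [ours; bookkeeping] -/
theorem norm_add_smul_sq (x h : E) (t : ℝ) :
    ‖x + t • h‖ ^ 2 = ‖x‖ ^ 2 + 2 * ⟪x, h⟫_ℝ * t + ‖h‖ ^ 2 * t ^ 2 := by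
  rw [norm_add_sq_real, real_inner_smul_right, norm_smul, Real.norm_eq_abs, mul_pow, sq_abs]
  ring

/-- `‖x + th‖ = √(q(t))`. [ours; bookkeeping] -/
theorem norm_add_smul (x h : E) (t : ℝ) :
    ‖x + t • h‖ = Real.sqrt (‖x‖ ^ 2 + 2 * ⟪x, h⟫_ℝ * t + ‖h‖ ^ 2 * t ^ 2) := by
  rw [← norm_add_smul_sq, Real.sqrt_sq (norm_nonneg _)]

/-- **Burkholder's `u_λ` along a line is the profile at `(√q(t), √p(t))`.** [ours; bookkeeping] -/
theorem burkholderU_line (lam : ℝ) (x y h k : E) (t : ℝ) :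
    burkholderU lam (x + t • h) (y + t • k)
      = uProf lam (Real.sqrt (‖x‖ ^ 2 + 2 * ⟪x, h⟫_ℝ * t + ‖h‖ ^ 2 * t ^ 2))
          (Real.sqrt (‖y‖ ^ 2 + 2 * ⟪y, k⟫_ℝ * t + ‖k‖ ^ 2 * t ^ 2)) := by
  rw [burkholderU_eq_uProf, norm_add_smul, norm_add_smul]

/-- Cauchy–Schwarz in the form `e² ≤ d·f` (`⟪y, k⟫² ≤ ‖y‖²‖k‖²`). [ours; bookkeeping] -/
theorem inner_sq_le_norm_sq_mul (y k : E) : ⟪y, k⟫_ℝ ^ 2 ≤ ‖y‖ ^ 2 * ‖k‖ ^ 2 := by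
  have h := abs_real_inner_le_norm y k
  have h2 := mul_self_le_mul_self (abs_nonneg _) h
  nlinarith [sq_abs ⟪y, k⟫_ℝ]

/-- **The domain of the line**: for `c > 0` and `a ≤ 1`, `{t : a + 2bt + ct² ≤ 1}` is the closed interval between the
roots `(−b ∓ √(b² + c(1 − a)))/c` of `q = 1`. [ours; elementary] -/
theorem setOf_quad_le_one {a b c : ℝ} (hc : 0 < c) (ha : a ≤ 1) :
    {t : ℝ | a + 2 * b * t + c * t ^ 2 ≤ 1}
      = Icc ((-b - Real.sqrt (b ^ 2 + c * (1 - a))) / c) ((-b + Real.sqrt (b ^ 2 + c * (1 - a))) / c) := by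
  have hD : 0 ≤ b ^ 2 + c * (1 - a) := by nlinarith [sq_nonneg b]
  have hs0 : 0 ≤ Real.sqrt (b ^ 2 + c * (1 - a)) := Real.sqrt_nonneg _
  have hs2 : Real.sqrt (b ^ 2 + c * (1 - a)) ^ 2 = b ^ 2 + c * (1 - a) := Real.sq_sqrt hD
  ext t
  simp only [mem_setOf_eq, mem_Icc]
  rw [div_le_iff₀ hc, le_div_iff₀ hc]
  constructor
  · intro h
    have h1 : (c * t + b) ^ 2 ≤ Real.sqrt (b ^ 2 + c * (1 - a)) ^ 2 := by
      rw [hs2]; nlinarith [mul_le_mul_of_nonneg_left h hc.le]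
    obtain ⟨h2, h3⟩ := abs_le_of_sq_le_sq' h1 hs0
    constructor <;> linarith
  · rintro ⟨h2, h3⟩
    have h2' : -(Real.sqrt (b ^ 2 + c * (1 - a))) ≤ c * t + b := by linarith
    have h3' : c * t + b ≤ Real.sqrt (b ^ 2 + c * (1 - a)) := by linarith
    have h1 : (c * t + b) ^ 2 ≤ Real.sqrt (b ^ 2 + c * (1 - a)) ^ 2 := sq_le_sq' h2' h3'
    rw [hs2] at h1
    nlinarith

/-- The domain `I = {t : ‖x + th‖ ≤ 1}` of Burkholder's `G` as that interval (`‖x‖ ≤ 1`, `h ≠ 0`). [ours; bookkeeping] -/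
theorem setOf_norm_add_smul_le_one {x h : E} (hx : ‖x‖ ≤ 1) (hh : 0 < ‖h‖) :
    {t : ℝ | ‖x + t • h‖ ≤ 1}
      = Icc ((-⟪x, h⟫_ℝ - Real.sqrt (⟪x, h⟫_ℝ ^ 2 + ‖h‖ ^ 2 * (1 - ‖x‖ ^ 2))) / ‖h‖ ^ 2)
          ((-⟪x, h⟫_ℝ + Real.sqrt (⟪x, h⟫_ℝ ^ 2 + ‖h‖ ^ 2 * (1 - ‖x‖ ^ 2))) / ‖h‖ ^ 2) := by
  have ha : ‖x‖ ^ 2 ≤ 1 := by nlinarith [norm_nonneg x]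
  rw [← setOf_quad_le_one (by positivity) ha]
  ext t
  simp only [mem_setOf_eq]
  rw [← norm_add_smul_sq]
  constructor
  · intro h1; nlinarith [norm_nonneg (x + t • h)]
  · intro h1; nlinarith [norm_nonneg (x + t • h)]

end Burk

end Summit.NavierStokesRegularity.FunctionalMining

end
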